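import Literature.NumberTheory.PAdicHodge.TateAlmostEtaleEtaleStep
import HarnessLib

/-!
# Ramified tame steps: the almost-perfectoid package along `ℓ`-th roots of NON-units (`ℓ ≠ p`)
# (toward Tate's almost étale lemma — the prime-to-`p` part, Tate 1967 §3.2 Prop. 9 / Berger–Colmez (TS1))

Notation of `TateAlmostEtaleIntegralBases` / `TateAlmostEtaleEtaleStep` (`K₀ ⊆ M ⊆ F̄ = NormedAlgClosure F`,
package `pkg_s(M)` = (Γ) `‖M^×‖` is `p`-divisible + (U_s) every integer of `M` is a `p`-th power modulo `p^s`).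
`TateAlmostEtaleEtaleStep` propagates the package along ÉTALE steps (roots of unity of order prime to `p`, unit
radicals with unit different). This file does the complementary RAMIFIED tame step:

* `TateAlmostEtale.norm_pow_ne_norm_of_lt` : if `α^ℓ ∈ M` (`ℓ` prime) and `‖α‖ ∉ ‖M‖`, then `‖α‖^n ∉ ‖M‖` for
  `0 < n < ℓ` (Bezout);
* `TateAlmostEtale.norm_sum_mul_pow_eq` : hence the powers `1, α, …, α^{d-1}` (`d ≤ ℓ`) are ORTHOGONAL over `M`:
  `‖Σ λ_i α^i‖ = max ‖λ_i‖ ‖α‖^i` (distinct value cosets; Mathlib `IsUltrametricDist.norm_sum_eq_sup'_of_pairwise_ne`);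
* `TateAlmostEtale.adjoin_radical_package` (**main**) : **`pkg_s(M)`, `α^ℓ ∈ M`, `ℓ ≠ p` prime, `‖α‖ ∉ ‖M‖ ⇒
  `pkg_{min s 1}(M⟮α⟯)`**: (Γ′) from orthogonality and `‖α‖^j = ‖α^a‖^p / ‖(α^ℓ)^t‖` for `a p = ℓ t + j`;
  (U′) termwise — `λ_j α^j = x_j (α^{a_j})^p` with `x_j = λ_j (α^ℓ)^{-t_j} ∈ M ≈ (d_j w_j)^p` by `pkg_s(M)` — and
  `(Σ W_j)^p ≡ Σ W_j^p (mod p)` (`norm_sum_pow_sub_sum_pow_le'`).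

With `adjoin_rootOfUnity_package` this covers every step of a tower `K_∞ ⊆ K_∞(ζ_N) ⊆ K_∞(ζ_N, c^{1/e})`
(`p ∤ N e`): the radical-ascent half of obligation (C) of the Kummer route to (TS1)
(`Cruxes/StarredOptimalManinUnitFiveSeven/Lines/kato-lever-TS1-kummer-route.md` §4 (i)); the other half is the
tame structure theorem (Lang, ANT II §5 Prop. 12), not treated here. Own elementary route; statement served:
Tate 1967 §3.2 Prop. 9 / Berger–Colmez 2008 Prop. 4.1.1. No `sorry`, no definitions. BSD is not proved here.
-/

noncomputable section

open Polynomial IntermediateField Module ValuativeRel Field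

namespace Literature.NumberTheory.PAdicHodge

namespace TateAlmostEtale

open Literature.NumberTheory.GaloisRepresentations
open Literature.NumberTheory.GaloisRepresentations.IsNonarchimedeanLocalField

variable {F : Type} [Field F] [ValuativeRel F] [TopologicalSpace F] [IsNonarchimedeanLocalField F]
  [CharZero F] {p : ℕ} [Fact p.Prime] (hp : valuation F p < 1)

section Radical

variable (M : IntermediateField (PadicBase F p hp) (NormedAlgClosure F))
  {ℓ : ℕ} (hℓ : ℓ.Prime) {α : NormedAlgClosure F} (hαℓ : α ^ ℓ ∈ M) (hnv : ∀ m ∈ M, ‖m‖ ≠ ‖α‖)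

/-! ### Arithmetic of exponents and an ultrametric helper -/

/-- `‖x − y‖ ≤ max ‖x‖ ‖y‖` in an ultrametric group. [folklore] -/
private theorem norm_sub_le_max'' {E : Type*} [SeminormedAddCommGroup E] [IsUltrametricDist E] (x y : E) :
    ‖x - y‖ ≤ max ‖x‖ ‖y‖ := by
  rw [sub_eq_add_neg, ← norm_neg y]
  exact IsUltrametricDist.norm_add_le_max x (-y)

omit [ValuativeRel F] [TopologicalSpace F] [IsNonarchimedeanLocalField F] [CharZero F] [Fact p.Prime] in
/-- Bezout for exponents: if `n` is prime to the prime `ℓ` then `a n = ℓ t + j` has a solution for every `j`.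
[folklore] -/
private theorem exists_mul_eq_mul_add {ℓ : ℕ} (hℓ : ℓ.Prime) {n : ℕ} (hn : ¬ ℓ ∣ n) (j : ℕ) :
    ∃ a t : ℕ, a * n = ℓ * t + j := by
  have hcop : Nat.Coprime n ℓ := (Nat.Prime.coprime_iff_not_dvd hℓ).mpr hn |>.symm
  obtain ⟨m, -, hm⟩ := Nat.exists_mul_mod_eq_one_of_coprime hcop hℓ.one_lt
  refine ⟨m * j, n * m / ℓ * j, ?_⟩
  have h := Nat.div_add_mod (n * m) ℓ
  rw [hm] at h
  calc m * j * n = (n * m) * j := by ring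
    _ = (ℓ * (n * m / ℓ) + 1) * j := by rw [h]
    _ = ℓ * (n * m / ℓ * j) + j := by ring

include hαℓ hnv in
/-- `α ≠ 0` (otherwise `‖α‖ = ‖0‖ ∈ ‖M‖`). [folklore] -/
private theorem radical_ne_zero : α ≠ 0 := by
  rintro rfl
  exact hnv 0 (zero_mem M) rfl

include hℓ hαℓ hnv in
/-- **Value cosets**: if `α^ℓ ∈ M`, `ℓ` prime, and `‖α‖ ∉ ‖M‖`, then `‖α‖^n ∉ ‖M‖` for `0 < n < ℓ` (write
`u n = ℓ q + 1`; `‖m‖ = ‖α‖^n` would give `‖α‖ = ‖m^u / (α^ℓ)^q‖ ∈ ‖M‖`). [cite: SerreLocalFields1979, Ch. I §6 (totally ramified radical extensions)] -/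
theorem norm_pow_ne_norm_of_lt {n : ℕ} (hn0 : 0 < n) (hnℓ : n < ℓ) : ∀ m ∈ M, ‖m‖ ≠ ‖α‖ ^ n := by
  intro m hm hmn
  have hα0 : α ≠ 0 := radical_ne_zero hp M hαℓ hnv
  have hndvd : ¬ ℓ ∣ n := fun h => absurd (Nat.le_of_dvd hn0 h) (not_le.mpr hnℓ)
  obtain ⟨u, q, huq⟩ := exists_mul_eq_mul_add hℓ hndvd 1
  -- `‖m^u‖ = ‖α‖^{u n} = ‖(α^ℓ)^q‖ ‖α‖`
  have h1 : ‖m ^ u‖ = ‖(α ^ ℓ) ^ q‖ * ‖α‖ := by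
    rw [norm_pow, hmn, ← pow_mul, mul_comm n u, huq, pow_add, pow_one, pow_mul, norm_pow, norm_pow]
  have hc0 : (α ^ ℓ) ^ q ≠ 0 := pow_ne_zero _ (pow_ne_zero _ hα0)
  refine hnv (m ^ u / (α ^ ℓ) ^ q) (div_mem (pow_mem hm u) (pow_mem hαℓ q)) ?_
  rw [norm_div, h1, mul_div_cancel_left₀ _ (norm_ne_zero_iff.mpr hc0)]

/-! ### Orthogonality of `1, α, …, α^{d-1}` over `M` -/

include hℓ hαℓ hnv in
/-- **The powers `α^i`, `i < d ≤ ℓ`, are orthogonal over `M`**: for `λ_i ∈ M`, every term satisfies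
`‖λ_i‖ ‖α‖^i ≤ ‖Σ_i λ_i α^i‖`, and the norm of the sum is attained at some nonzero term (nonzero terms have
pairwise distinct norms, as `‖α‖^{j-i} ∉ ‖M‖` for `0 < j - i < ℓ`).
[cite: SerreLocalFields1979, Ch. I §6] [cite: Tate1967, §3.2] -/
theorem norm_sum_mul_pow_eq {d : ℕ} (hd : d ≤ ℓ) (c : Fin d → NormedAlgClosure F) (hc : ∀ i, c i ∈ M) :
    (∀ i, ‖c i‖ * ‖α‖ ^ (i : ℕ) ≤ ‖∑ i, c i * α ^ (i : ℕ)‖) ∧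
      ((∑ i, c i * α ^ (i : ℕ)) ≠ 0 → ∃ i, c i ≠ 0 ∧ ‖∑ i, c i * α ^ (i : ℕ)‖ = ‖c i‖ * ‖α‖ ^ (i : ℕ)) := by
  classical
  have hα0 : α ≠ 0 := radical_ne_zero hp M hαℓ hnv
  set f : Fin d → NormedAlgClosure F := fun i => c i * α ^ (i : ℕ) with hf
  have hnf : ∀ i, ‖f i‖ = ‖c i‖ * ‖α‖ ^ (i : ℕ) := fun i => by rw [hf, norm_mul, norm_pow]
  set S : Finset (Fin d) := Finset.univ.filter fun i => c i ≠ 0 with hS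
  have hsum : (∑ i, c i * α ^ (i : ℕ)) = ∑ i ∈ S, f i := by
    rw [hS, Finset.sum_filter]
    refine Finset.sum_congr rfl fun i _ => ?_
    by_cases h : c i ≠ 0
    · rw [if_pos h]
    · rw [if_neg h, not_not.mp h, zero_mul]
  -- nonzero terms have pairwise distinct norms
  -- the key asymmetric case
  have key : ∀ i j : Fin d, c j ≠ 0 → (i : ℕ) < (j : ℕ) → ‖f i‖ = ‖f j‖ → False := by
    intro i j hj hlt heq
    rw [hnf, hnf] at heq
    have hn0 : 0 < (j : ℕ) - (i : ℕ) := Nat.sub_pos_of_lt hlt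
    have hnℓ : (j : ℕ) - (i : ℕ) < ℓ := lt_of_le_of_lt (Nat.sub_le _ _) (lt_of_lt_of_le j.2 hd)
    refine norm_pow_ne_norm_of_lt hp M hℓ hαℓ hnv hn0 hnℓ (c i / c j) (div_mem (hc i) (hc j)) ?_
    have hcj : ‖c j‖ ≠ 0 := norm_ne_zero_iff.mpr hj
    have hαi : ‖α‖ ^ (i : ℕ) ≠ 0 := pow_ne_zero _ (norm_ne_zero_iff.mpr hα0)
    have hsplit : ‖α‖ ^ (j : ℕ) = ‖α‖ ^ ((j : ℕ) - (i : ℕ)) * ‖α‖ ^ (i : ℕ) := by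
      rw [← pow_add, Nat.sub_add_cancel hlt.le]
    rw [hsplit, ← mul_assoc] at heq
    have h3 : ‖c i‖ = ‖c j‖ * ‖α‖ ^ ((j : ℕ) - (i : ℕ)) := mul_right_cancel₀ hαi heq
    rw [norm_div, h3, mul_div_cancel_left₀ _ hcj]
  have hpair : Set.Pairwise (S : Set (Fin d)) fun i j => ‖f i‖ ≠ ‖f j‖ := by
    intro i hi j hj hij heq
    simp only [hS, Finset.coe_filter, Finset.mem_univ, true_and, Set.mem_setOf_eq] at hi hj
    rcases lt_trichotomy (i : ℕ) (j : ℕ) with hlt | heq' | hgt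
    · exact key i j hj hlt heq
    · exact hij (Fin.ext heq')
    · exact key j i hi hgt heq.symm
  refine ⟨fun i => ?_, fun hx => ?_⟩
  · by_cases hci : c i = 0
    · rw [hci, norm_zero, zero_mul]; exact norm_nonneg _
    · have hiS : i ∈ S := by simp [hS, hci]
      have hSne : S.Nonempty := ⟨i, hiS⟩
      have hsup : ‖∑ i ∈ S, f i‖ = S.sup' hSne (fun i => ‖f i‖) :=
        IsUltrametricDist.norm_sum_eq_sup'_of_pairwise_ne hSne hpair
      rw [hsum, hsup, ← hnf]
      exact Finset.le_sup' (fun i => ‖f i‖) hiS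
  · have hSne : S.Nonempty := by
      by_contra h
      rw [Finset.not_nonempty_iff_eq_empty] at h
      exact hx (by rw [hsum, h, Finset.sum_empty])
    have hsup : ‖∑ i ∈ S, f i‖ = S.sup' hSne (fun i => ‖f i‖) :=
      IsUltrametricDist.norm_sum_eq_sup'_of_pairwise_ne hSne hpair
    obtain ⟨i, hiS, hi⟩ := Finset.exists_mem_eq_sup' hSne fun i => ‖f i‖
    refine ⟨i, (Finset.mem_filter.mp hiS).2, ?_⟩
    rw [hsum, hsup, hi, hnf]

/-! ### Coordinates in `M⟮α⟯` -/

include hℓ hαℓ hnv in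
/-- Every `x ∈ M⟮α⟯` is `Σ_{i<d} λ_i α^i` with `λ_i ∈ M` and `d ≤ ℓ` (power basis of `M⟮α⟯`, `deg minpoly ≤ ℓ`).
[folklore] [cite: SerreLocalFields1979, Ch. I §6] -/
theorem exists_eq_sum_mul_pow (x : NormedAlgClosure F) (hx : x ∈ (↥M)⟮α⟯) :
    ∃ (d : ℕ) (_ : d ≤ ℓ) (c : Fin d → NormedAlgClosure F), (∀ i, c i ∈ M) ∧ x = ∑ i, c i * α ^ (i : ℕ) := by
  classical
  have hα0 : α ≠ 0 := radical_ne_zero hp M hαℓ hnv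
  have hPmo : (X ^ ℓ - C (⟨α ^ ℓ, hαℓ⟩ : ↥M)).Monic := monic_X_pow_sub_C _ hℓ.ne_zero
  have hPα : aeval α (X ^ ℓ - C (⟨α ^ ℓ, hαℓ⟩ : ↥M)) = 0 := by simp
  have hint : IsIntegral M α := ⟨X ^ ℓ - C (⟨α ^ ℓ, hαℓ⟩ : ↥M), hPmo, by simp⟩
  set pb : PowerBasis M (↥M)⟮α⟯ := adjoin.powerBasis hint with hpb
  have hdim : pb.dim ≤ ℓ := by
    have h1 : pb.dim = (minpoly M α).natDegree := by rw [hpb, adjoin.powerBasis_dim]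
    have h2 : (minpoly M α).natDegree ≤ (X ^ ℓ - C (⟨α ^ ℓ, hαℓ⟩ : ↥M)).natDegree :=
      natDegree_le_natDegree (minpoly.min M α hPmo hPα)
    rw [h1]
    exact h2.trans (by rw [natDegree_X_pow_sub_C])
  refine ⟨pb.dim, hdim, fun i => ((pb.basis.repr ⟨x, hx⟩ i : M) : NormedAlgClosure F), fun i => (pb.basis.repr ⟨x, hx⟩ i).2, ?_⟩
  have h := pb.basis.sum_repr ⟨x, hx⟩
  have hgen : ((pb.gen : (↥M)⟮α⟯) : NormedAlgClosure F) = α := by rw [hpb, adjoin.powerBasis_gen]; rfl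
  calc x = (((∑ i, pb.basis.repr ⟨x, hx⟩ i • pb.basis i) : (↥M)⟮α⟯) : NormedAlgClosure F) := by rw [h]
    _ = ∑ i, ((pb.basis.repr ⟨x, hx⟩ i : M) : NormedAlgClosure F) * α ^ (i : ℕ) := by
        rw [IntermediateField.coe_sum]
        refine Finset.sum_congr rfl fun i _ => ?_
        rw [pb.coe_basis, IntermediateField.coe_smul, IntermediateField.coe_pow, hgen, Algebra.smul_def]
        rfl

/-! ### The package along a ramified radical step -/

include hℓ hαℓ hnv in
/-- **The package propagates along ramified radical steps.** If `pkg_s(M)` holds, `ℓ ≠ p` is prime, `α^ℓ ∈ M`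
and `‖α‖ ∉ ‖M‖` (a totally ramified Kummer step of degree prime to `p`), then `pkg_{min s 1}(M⟮α⟯)`:
(Γ′) `‖Σ λ_i α^i‖ = ‖λ_j‖‖α‖^j = ‖c₁ c₂ α^a‖^p` with `a p = ℓ t + j`, `‖c₁‖^p = ‖λ_j‖`, `‖c₂‖^p = ‖(α^ℓ)^{-t}‖`;
(U′) each term `λ_j α^j = x_j (α^{a_j})^p`, `x_j ∈ M`, is within `‖λ_j α^j‖ ‖p‖^s` of a `p`-th power
`(d_j w_j α^{a_j})^p` by `pkg_s(M)`, and `(Σ W_j)^p ≡ Σ W_j^p (mod p)`.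
[cite: Tate1967, §3.2 Prop. 9] [cite: BergerColmez2008, Prop. 4.1.1] -/
theorem adjoin_radical_package (hℓp : ℓ ≠ p) {s : ℝ} (hs : 0 < s)
    (hΓ : ∀ x ∈ M, x ≠ 0 → ∃ c ∈ M, ‖c‖ ^ p = ‖x‖)
    (hU : ∀ u ∈ M, ‖u‖ ≤ 1 → ∃ w ∈ M, ‖u - w ^ p‖ ≤ ‖(p : NormedAlgClosure F)‖ ^ s) :
    (∀ x ∈ (↥M)⟮α⟯, x ≠ 0 → ∃ c ∈ (↥M)⟮α⟯, ‖c‖ ^ p = ‖x‖) ∧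
      (∀ u ∈ (↥M)⟮α⟯, ‖u‖ ≤ 1 → ∃ w ∈ (↥M)⟮α⟯, ‖u - w ^ p‖ ≤ ‖(p : NormedAlgClosure F)‖ ^ (min s 1)) := by
  classical
  have hprime : p.Prime := Fact.out
  have hα0 : α ≠ 0 := radical_ne_zero hp M hαℓ hnv
  have hαL : α ∈ (↥M)⟮α⟯ := mem_adjoin_simple_self _ α
  have hML : ∀ m ∈ M, m ∈ (↥M)⟮α⟯ := fun m hm => IntermediateField.algebraMap_mem (↥M)⟮α⟯ (⟨m, hm⟩ : ↥M)
  have hpℓ : ¬ ℓ ∣ p := fun h => hℓp ((Nat.prime_dvd_prime_iff_eq hℓ hprime).mp h)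
  have hq1 : ‖(p : NormedAlgClosure F)‖ < 1 := by
    rw [PadicBase.norm_natCast_closure hp]; exact PadicBase.norm_p_lt_one hp
  have hq0 : 0 < ‖(p : NormedAlgClosure F)‖ := by
    rw [PadicBase.norm_natCast_closure hp]; exact PadicBase.norm_p_pos hp
  have hps1 : ‖(p : NormedAlgClosure F)‖ ^ s ≤ 1 := Real.rpow_le_one (norm_nonneg _) hq1.le hs.le
  -- `‖α‖^j = ‖α^a‖^p / ‖(α^ℓ)^t‖` with `a p = ℓ t + j`
  have hexp : ∀ j : ℕ, ∃ a t : ℕ, ‖α‖ ^ j * ‖(α ^ ℓ) ^ t‖ = ‖α ^ a‖ ^ p := by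
    intro j
    obtain ⟨a, t, hat⟩ := exists_mul_eq_mul_add hℓ hpℓ j
    refine ⟨a, t, ?_⟩
    simp only [norm_pow, ← pow_mul]
    rw [hat, pow_add, mul_comm]
  refine ⟨fun x hx hx0 => ?_, fun u hu hu1 => ?_⟩
  · -- (Γ′)
    obtain ⟨d, hd, c, hcM, rfl⟩ := exists_eq_sum_mul_pow hp M hℓ hαℓ hnv x hx
    obtain ⟨j, hcj, hnorm⟩ := (norm_sum_mul_pow_eq hp M hℓ hαℓ hnv hd c hcM).2 hx0
    obtain ⟨a, t, hat⟩ := hexp j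
    obtain ⟨c₁, hc₁M, hc₁⟩ := hΓ (c j) (hcM j) hcj
    have hct0 : ((α ^ ℓ) ^ t)⁻¹ ≠ 0 := inv_ne_zero (pow_ne_zero _ (pow_ne_zero _ hα0))
    obtain ⟨c₂, hc₂M, hc₂⟩ := hΓ ((α ^ ℓ) ^ t)⁻¹ (inv_mem (pow_mem hαℓ t)) hct0
    refine ⟨c₁ * c₂ * α ^ a, mul_mem (mul_mem (hML _ hc₁M) (hML _ hc₂M)) (pow_mem hαL a), ?_⟩
    have hct : ‖(α ^ ℓ) ^ t‖ ≠ 0 := norm_ne_zero_iff.mpr (pow_ne_zero _ (pow_ne_zero _ hα0))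
    rw [hnorm, norm_mul, norm_mul, mul_pow, mul_pow, hc₁, hc₂, ← hat, norm_inv]
    field_simp
  · -- (U′)
    obtain ⟨d, hd, c, hcM, rfl⟩ := exists_eq_sum_mul_pow hp M hℓ hαℓ hnv u hu
    have hterm := (norm_sum_mul_pow_eq hp M hℓ hαℓ hnv hd c hcM).1
    -- termwise approximation by `p`-th powers
    have hW : ∀ i : Fin d, ∃ W ∈ (↥M)⟮α⟯, ‖W‖ ≤ 1 ∧
        ‖c i * α ^ (i : ℕ) - W ^ p‖ ≤ ‖(p : NormedAlgClosure F)‖ ^ s := by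
      intro i
      by_cases hci : c i = 0
      · exact ⟨0, zero_mem _, by rw [norm_zero]; exact zero_le_one,
          by rw [hci, zero_mul, zero_pow hprime.ne_zero, sub_zero, norm_zero]; positivity⟩
      obtain ⟨a, t, hat⟩ := exists_mul_eq_mul_add hℓ hpℓ (i : ℕ)
      -- `x := c_i (α^ℓ)^{-t} ∈ M`, `c_i α^i = x (α^a)^p`
      obtain ⟨x, hxdef⟩ : ∃ x : NormedAlgClosure F, x = c i * ((α ^ ℓ) ^ t)⁻¹ := ⟨_, rfl⟩
      have hxM : x ∈ M := by rw [hxdef]; exact mul_mem (hcM i) (inv_mem (pow_mem hαℓ t))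
      have hct0 : (α ^ ℓ) ^ t ≠ 0 := pow_ne_zero _ (pow_ne_zero _ hα0)
      have hx0 : x ≠ 0 := by rw [hxdef]; exact mul_ne_zero hci (inv_ne_zero hct0)
      have hTi : c i * α ^ (i : ℕ) = x * (α ^ a) ^ p := by
        rw [hxdef, ← pow_mul α a p, hat, pow_add, pow_mul, mul_assoc, inv_mul_cancel_left₀ hct0]
      obtain ⟨dd, hddM, hdd⟩ := hΓ x hxM hx0
      have hdd0 : dd ≠ 0 := by
        intro h; rw [h, norm_zero, zero_pow hprime.ne_zero] at hdd; exact hx0 (norm_eq_zero.mp hdd.symm)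
      have hun : ‖x / dd ^ p‖ ≤ 1 := by
        rw [norm_div, norm_pow, hdd, div_self (norm_ne_zero_iff.mpr hx0)]
      obtain ⟨w, hwM, hw⟩ := hU (x / dd ^ p) (div_mem hxM (pow_mem hddM p)) hun
      have hT1 : ‖c i * α ^ (i : ℕ)‖ ≤ 1 := by rw [norm_mul, norm_pow]; exact (hterm i).trans hu1
      have hxd : dd ^ p * (x / dd ^ p) = x := by field_simp
      have hdiff : c i * α ^ (i : ℕ) - (dd * w * α ^ a) ^ p = (dd ^ p * (x / dd ^ p - w ^ p)) * (α ^ a) ^ p := by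
        rw [hTi, mul_sub, hxd]; ring
      have hest : ‖c i * α ^ (i : ℕ) - (dd * w * α ^ a) ^ p‖ ≤ ‖(p : NormedAlgClosure F)‖ ^ s := by
        rw [hdiff, norm_mul, norm_mul, norm_pow dd, hdd]
        calc ‖x‖ * ‖x / dd ^ p - w ^ p‖ * ‖(α ^ a) ^ p‖
            ≤ ‖x‖ * ‖(p : NormedAlgClosure F)‖ ^ s * ‖(α ^ a) ^ p‖ := by gcongr
          _ = ‖c i * α ^ (i : ℕ)‖ * ‖(p : NormedAlgClosure F)‖ ^ s := by rw [hTi, norm_mul, mul_right_comm]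
          _ ≤ 1 * ‖(p : NormedAlgClosure F)‖ ^ s := by gcongr
          _ = _ := one_mul _
      refine ⟨dd * w * α ^ a, mul_mem (mul_mem (hML _ hddM) (hML _ hwM)) (pow_mem hαL a), ?_, hest⟩
      -- `‖W‖ ≤ 1` from `‖W^p‖ ≤ max ‖T‖ ‖T − W^p‖ ≤ 1`
      have hWp : ‖(dd * w * α ^ a) ^ p‖ ≤ 1 := by
        have h1 : (dd * w * α ^ a) ^ p = c i * α ^ (i : ℕ) - (c i * α ^ (i : ℕ) - (dd * w * α ^ a) ^ p) := by ring
        rw [h1]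
        exact (norm_sub_le_max'' _ _).trans (max_le hT1 (hest.trans hps1))
      rw [norm_pow] at hWp
      exact (pow_le_one_iff_of_nonneg (norm_nonneg _) hprime.ne_zero).mp hWp
    choose W hWL hW1 hWp using hW
    refine ⟨∑ i, W i, sum_mem fun i _ => hWL i, ?_⟩
    -- `u − (Σ W)^p = Σ (T_i − W_i^p) − ((Σ W)^p − Σ W_i^p)`
    have hA : ‖∑ i, (c i * α ^ (i : ℕ) - W i ^ p)‖ ≤ ‖(p : NormedAlgClosure F)‖ ^ s :=
      IsUltrametricDist.norm_sum_le_of_forall_le_of_nonneg (by positivity) fun i _ => hWp i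
    have hB : ‖(∑ i, W i) ^ p - ∑ i, W i ^ p‖ ≤ ‖(p : NormedAlgClosure F)‖ := by
      have h := norm_sum_pow_sub_sum_pow_le' hprime Finset.univ W le_rfl fun i _ => hW1 i
      rwa [one_pow, mul_one] at h
    have hsd : ∑ i, (c i * α ^ (i : ℕ) - W i ^ p) = (∑ i, c i * α ^ (i : ℕ)) - ∑ i, W i ^ p :=
      Finset.sum_sub_distrib (fun i => c i * α ^ (i : ℕ)) (fun i => W i ^ p)
    have heq : (∑ i, c i * α ^ (i : ℕ)) - (∑ i, W i) ^ p =
        ∑ i, (c i * α ^ (i : ℕ) - W i ^ p) - ((∑ i, W i) ^ p - ∑ i, W i ^ p) := by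
      rw [hsd]; ring
    rw [heq]
    refine (norm_sub_le_max'' _ _).trans (max_le (hA.trans ?_) (hB.trans ?_))
    · exact Real.rpow_le_rpow_of_exponent_ge hq0 hq1.le (min_le_left s 1)
    · calc ‖(p : NormedAlgClosure F)‖ = ‖(p : NormedAlgClosure F)‖ ^ (1 : ℝ) := (Real.rpow_one _).symm
        _ ≤ _ := Real.rpow_le_rpow_of_exponent_ge hq0 hq1.le (min_le_right s 1)

end Radical

end TateAlmostEtale

end Literature.NumberTheory.PAdicHodge

end
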